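import Literature.Combinatorics.Enumerative.PolynomialRangeSums
import Literature.Barriers.ValiantsHypothesis.FSV18UniversalConstructions
import HarnessLib

/-!
# Iterated range sums of polynomials: degree bookkeeping
# (an affine-length range sum raises the total degree by at most one)

## Sources

[St] R. P. Stanley, *Enumerative Combinatorics, Vol. 1*, 2nd ed. (CUP 2012), §4.6.2, Theorem 4.6.8 (the Ehrhart quasipolynomial of a
rational `d`-polytope has degree `d`); Chapter 4, Exercise 38 (parametric linear systems).
[KP] M. Kauers, P. Paule, *The Concrete Tetrahedron* (Springer 2011), Sect. 3.3 (partial summation raises the degree of a polynomial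
sequence by exactly one; here only the upper bound, in several variables and relative to a chamber).
[FSV] M. Forbes, A. Shpilka, B. L. Volk, *Succinct hitting sets and barriers to proving lower bounds for algebraic circuits*, ToC 14
(2018), proof of Lemma 3.3: `deg g(θ) ≤ deg g · max deg θ_i` — in this tree `Literature.Barriers.ValiantsHypothesis.FSV2018.totalDegree_bind₁_le_mul`
(imported, not restated).

## What is formalised (everything proved)

The degree-tracking twin of `Literature.Combinatorics.Enumerative.PolynomialRangeSums` (car «POLYNOMIAL RANGE SUMS»):
* `IsPolyOnDeg D n f` — `f : ℤ^d → ℚ` agrees on `D` with a polynomial of total degree `≤ n`; `IsPolyOnDeg.isPolyOn`; closure with the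
  obvious degree arithmetic: `of_le`, `mono`, `congr`, `const` (0), `coord` (1), `add`/`neg`/`sub` (max), `const_mul`, `mul` (`n + m`), `pow` (`k·n`),
  `sum`, `peval` (`deg S · n`), `comp` (`n · a` for a substitution of degree `≤ a`, via [FSV]).
* (the degree bound `deg F_p ≤ p + 1` is proved inline where it is used; its `ℝ[X]` form is the landed
  `Literature.NumberTheory.LFunctions.GORZAsymp.natDegree_faulhaber_le`).
* ★ `IsPolyOnDeg.sum_range` — for an AFFINE length `len` (degree `≤ 1`, `≥ 0` on `D`) and a summand of total degree `≤ n` on the slab,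
  `x ↦ Σ_{0 ≤ j < len x} g(x, j)` has total degree `≤ n + 1` on `D` (the coefficient `c_p(x)` of `j^p` has degree `≤ n − p`,
  Mathlib's `MvPolynomial.totalDegree_coeff_finSuccEquiv_add_le`, and `F_p(len x)` has degree `≤ p + 1`);
  `IsPolyOnDeg.sum_range_shift` — the same over `[lo x, lo x + len x)` with `lo` affine.
* `IsPolyOnDeg.exists_polynomial_nat` — on the ray `{n ≥ 0} ⊆ ℤ¹`, an honest `Polynomial ℚ` of `natDegree ≤ m`.
* Worked example: the Beck–Robins pyramid count `Σ_{m ≤ t} (t − m + 1)²` has degree `≤ 3` on `t ≥ 0` (it is `(t+1)(t+2)(2t+3)/6`).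

So a `k`-fold interval-nested sum of a constant over affine ranges is a polynomial of total degree `≤ k` in the parameters on each chamber —
the degree half of FINDING-HEX-WALL-SLACK-FOUR-LAW §4b (5) (pub-sawmu lane).
-/

namespace Literature.Combinatorics.Enumerative.PolynomialRangeSums

open Finset

variable {d : ℕ}

/-- `f : ℤ^d → ℚ` agrees on `D` with a rational polynomial of total degree `≤ n`. OURS (notation).
[cite: Stanley2012EC1, §4.6.2, Theorem 4.6.8] -/
def IsPolyOnDeg (D : Set (Fin d → ℤ)) (n : ℕ) (f : (Fin d → ℤ) → ℚ) : Prop :=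
  ∃ P : MvPolynomial (Fin d) ℚ, P.totalDegree ≤ n ∧ ∀ x ∈ D, f x = MvPolynomial.eval (fun i => (x i : ℚ)) P

namespace IsPolyOnDeg

variable {D E : Set (Fin d → ℤ)} {f g : (Fin d → ℤ) → ℚ} {n m : ℕ}

/-- Forgetting the degree (plumbing). [cite: Stanley2012EC1, §4.6.2] -/
theorem isPolyOn (h : IsPolyOnDeg D n f) : IsPolyOn D f := by
  obtain ⟨P, -, hP⟩ := h
  exact ⟨P, hP⟩

/-- Weakening the degree bound (plumbing). [cite: Stanley2012EC1, §4.6.2] -/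
theorem of_le (h : IsPolyOnDeg D n f) (hnm : n ≤ m) : IsPolyOnDeg D m f := by
  obtain ⟨P, hPd, hP⟩ := h
  exact ⟨P, hPd.trans hnm, hP⟩

/-- Restriction to a smaller chamber (plumbing). [cite: Stanley2012EC1, §4.6.2] -/
theorem mono (h : IsPolyOnDeg D n f) (hE : E ⊆ D) : IsPolyOnDeg E n f := by
  obtain ⟨P, hPd, hP⟩ := h
  exact ⟨P, hPd, fun x hx => hP x (hE hx)⟩

/-- Functions agreeing on `D` are interchangeable (plumbing). [cite: Stanley2012EC1, §4.6.2] -/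
theorem congr (h : IsPolyOnDeg D n f) (hfg : ∀ x ∈ D, f x = g x) : IsPolyOnDeg D n g := by
  obtain ⟨P, hPd, hP⟩ := h
  exact ⟨P, hPd, fun x hx => (hfg x hx).symm.trans (hP x hx)⟩

/-- Constants have degree `0` (plumbing). [cite: Stanley2012EC1, §4.6.2] -/
theorem const (c : ℚ) : IsPolyOnDeg D 0 fun _ => c :=
  ⟨MvPolynomial.C c, by simp, fun x _ => by simp⟩

/-- Coordinates have degree `≤ 1` (plumbing). [cite: Stanley2012EC1, §4.6.2] -/
theorem coord (i : Fin d) : IsPolyOnDeg D 1 fun x => (x i : ℚ) :=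
  ⟨MvPolynomial.X i, by simp [MvPolynomial.totalDegree_X], fun x _ => by simp⟩

/-- Sums: degree `≤ max` (plumbing). [cite: Stanley2012EC1, §4.6.2] -/
theorem add (hf : IsPolyOnDeg D n f) (hg : IsPolyOnDeg D n g) : IsPolyOnDeg D n fun x => f x + g x := by
  obtain ⟨P, hPd, hP⟩ := hf
  obtain ⟨Q, hQd, hQ⟩ := hg
  refine ⟨P + Q, (MvPolynomial.totalDegree_add P Q).trans (max_le hPd hQd), fun x hx => ?_⟩
  dsimp only
  rw [hP x hx, hQ x hx, map_add]

/-- Negatives: same degree (plumbing). [cite: Stanley2012EC1, §4.6.2] -/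
theorem neg (hf : IsPolyOnDeg D n f) : IsPolyOnDeg D n fun x => -f x := by
  obtain ⟨P, hPd, hP⟩ := hf
  refine ⟨-P, by rwa [MvPolynomial.totalDegree_neg], fun x hx => ?_⟩
  dsimp only
  rw [hP x hx, map_neg]

/-- Differences: degree `≤ max` (plumbing). [cite: Stanley2012EC1, §4.6.2] -/
theorem sub (hf : IsPolyOnDeg D n f) (hg : IsPolyOnDeg D n g) : IsPolyOnDeg D n fun x => f x - g x :=
  (hf.add hg.neg).congr fun x _ => by ring

/-- Products: degrees add (plumbing). [cite: Stanley2012EC1, §4.6.2] -/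
theorem mul (hf : IsPolyOnDeg D n f) (hg : IsPolyOnDeg D m g) : IsPolyOnDeg D (n + m) fun x => f x * g x := by
  obtain ⟨P, hPd, hP⟩ := hf
  obtain ⟨Q, hQd, hQ⟩ := hg
  refine ⟨P * Q, (MvPolynomial.totalDegree_mul P Q).trans (Nat.add_le_add hPd hQd), fun x hx => ?_⟩
  dsimp only
  rw [hP x hx, hQ x hx, map_mul]

/-- Scalar multiples: same degree (plumbing). [cite: Stanley2012EC1, §4.6.2] -/
theorem const_mul (c : ℚ) (hf : IsPolyOnDeg D n f) : IsPolyOnDeg D n fun x => c * f x :=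
  ((const c).mul hf).of_le (by omega)

/-- Powers: degree `≤ k · n` (plumbing). [cite: Stanley2012EC1, §4.6.2] -/
theorem pow (hf : IsPolyOnDeg D n f) (k : ℕ) : IsPolyOnDeg D (k * n) fun x => f x ^ k := by
  obtain ⟨P, hPd, hP⟩ := hf
  refine ⟨P ^ k, (MvPolynomial.totalDegree_pow P k).trans (Nat.mul_le_mul_left k hPd), fun x hx => ?_⟩
  dsimp only
  rw [hP x hx, map_pow]

/-- Finite sums: degree `≤` the common bound (plumbing). [cite: Stanley2012EC1, §4.6.2] -/
theorem sum {ι : Type*} (s : Finset ι) (F : ι → (Fin d → ℤ) → ℚ) (h : ∀ i ∈ s, IsPolyOnDeg D n (F i)) :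
    IsPolyOnDeg D n fun x => ∑ i ∈ s, F i x := by
  classical
  induction s using Finset.induction_on with
  | empty => exact (const 0).of_le (Nat.zero_le _) |>.congr fun x _ => by simp
  | insert a s ha ih =>
    have h1 := (h a (mem_insert_self a s)).add (ih fun i hi => h i (mem_insert_of_mem hi))
    refine h1.congr fun x _ => ?_
    rw [sum_insert ha]

/-- A univariate polynomial `S` of a polynomial function of degree `≤ n` has degree `≤ deg S · n` (plumbing).
[cite: Stanley2012EC1, §4.6.2] -/
theorem peval (S : Polynomial ℚ) {s : ℕ} (hS : S.natDegree ≤ s) (hf : IsPolyOnDeg D n f) :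
    IsPolyOnDeg D (s * n) fun x => S.eval (f x) := by
  have h := sum (n := s * n) (range (S.natDegree + 1)) (fun i x => S.coeff i * f x ^ i) fun i hi => by
    have hi' : i ≤ s := (Nat.lt_succ_iff.1 (mem_range.1 hi)).trans hS
    have h1 := ((const (S.coeff i)).mul (hf.pow i)).of_le (m := s * n) (by nlinarith [Nat.zero_le n])
    exact h1
  exact h.congr fun x _ => (Polynomial.eval_eq_sum_range (p := S) (f x)).symm

/-- `eval` of a substituted polynomial (plumbing). [folklore] -/
private theorem eval_bind₁_prd {e : ℕ} (v : Fin d → ℚ) (Q : Fin e → MvPolynomial (Fin d) ℚ)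
    (P : MvPolynomial (Fin e) ℚ) :
    MvPolynomial.eval v (MvPolynomial.bind₁ Q P) = MvPolynomial.eval (fun j => MvPolynomial.eval v (Q j)) P :=
  MvPolynomial.eval₂Hom_bind₁ _ _ _ _

/-- Substitution: if `g` has degree `≤ n` on `E ⊆ ℤ^e` and every coordinate of `σ : ℤ^d → ℤ^e` has degree `≤ a` on `D`, with
`σ(D) ⊆ E`, then `g ∘ σ` has degree `≤ n · a` on `D` (the degree bound is [FSV]'s `totalDegree_bind₁_le_mul`).
[cite: Stanley2012EC1, §4.6.2; Chapter 4, Exercise 38] -/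
theorem comp {e : ℕ} {E : Set (Fin e → ℤ)} {g : (Fin e → ℤ) → ℚ} {a : ℕ} (hg : IsPolyOnDeg E n g)
    (σ : (Fin d → ℤ) → Fin e → ℤ) (hσ : ∀ j, IsPolyOnDeg D a fun x => (σ x j : ℚ))
    (hmaps : ∀ x ∈ D, σ x ∈ E) :
    IsPolyOnDeg D (n * a) fun x => g (σ x) := by
  obtain ⟨P, hPd, hP⟩ := hg
  choose Q hQd hQ using hσ
  refine ⟨MvPolynomial.bind₁ Q P, ?_, fun x hx => ?_⟩
  · exact (Literature.Barriers.ValiantsHypothesis.FSV2018.totalDegree_bind₁_le_mul Q a hQd P).trans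
      (Nat.mul_le_mul_right a hPd)
  · dsimp only
    rw [hP _ (hmaps x hx), eval_bind₁_prd]
    congr 1
    exact congrArg _ (funext fun j => by have h := hQ j x hx; dsimp only at h; exact h)

end IsPolyOnDeg

/-! ## The summation lemma with degrees -/

/-- The integer point `(j, x) ∈ ℤ^{d+1}` (new coordinate first). [folklore] -/
private theorem cast_cons_prd (j : ℤ) (x : Fin d → ℤ) :
    (fun i => ((Fin.cons j x : Fin (d + 1) → ℤ) i : ℚ)) = Fin.cons (j : ℚ) (fun i => (x i : ℚ)) := by
  funext i
  refine Fin.cases ?_ (fun i => ?_) i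
  · simp
  · simp

/-- ★ DEGREE OF A RANGE SUM. Let `D ⊆ ℤ^d`, let `len : ℤ^d → ℤ` be AFFINE (degree `≤ 1`) and non-negative on `D`, and let `g(x, j)` have
total degree `≤ n` on the slab `{(j, x) : x ∈ D, 0 ≤ j < len x}`. Then `x ↦ Σ_{0 ≤ j < len x} g(x, j)` has total degree `≤ n + 1` on `D`:
writing `g(x, j) = Σ_p c_p(x) j^p` with `deg c_p ≤ n − p` (Mathlib's `totalDegree_coeff_finSuccEquiv_add_le`), the sum is
`Σ_p c_p(x) F_p(len x)` and `deg F_p(len x) ≤ p + 1`. (Partial summation raises the degree by one, [KP] Sect. 3.3, in several variables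
and relative to a chamber; iterated, the Ehrhart degree bound `deg ≤ dim` of [St] Theorem 4.6.8 for interval-nested parametric polytopes.)
[cite: Stanley2012EC1, §4.6.2, Theorem 4.6.8; KauersPaule2011, Sect. 3.3] -/
theorem IsPolyOnDeg.sum_range {D : Set (Fin d → ℤ)} {len : (Fin d → ℤ) → ℤ} {g : (Fin d → ℤ) → ℤ → ℚ} {n : ℕ}
    (hlen : IsPolyOnDeg D 1 fun x => (len x : ℚ)) (hlen0 : ∀ x ∈ D, 0 ≤ len x)
    (hg : IsPolyOnDeg {y : Fin (d + 1) → ℤ | Fin.tail y ∈ D ∧ 0 ≤ y 0 ∧ y 0 < len (Fin.tail y)} n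
      fun y => g (Fin.tail y) (y 0)) :
    IsPolyOnDeg D (n + 1) fun x => ∑ j ∈ range (len x).toNat, g x j := by
  obtain ⟨P, hPd, hP⟩ := hg
  set Q : Polynomial (MvPolynomial (Fin d) ℚ) := MvPolynomial.finSuccEquiv ℚ d P with hQ
  set N : ℕ := Q.natDegree + 1 with hN
  -- (1) on the slab, `g x j = Σ_{p<N} c_p(x) j^p`
  have hexp : ∀ x ∈ D, ∀ j : ℕ, (j : ℤ) < len x →
      g x j = ∑ p ∈ range N, MvPolynomial.eval (fun i => (x i : ℚ)) (Q.coeff p) * (j : ℚ) ^ p := by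
    intro x hx j hj
    have hy : (Fin.cons (j : ℤ) x : Fin (d + 1) → ℤ) ∈
        {y : Fin (d + 1) → ℤ | Fin.tail y ∈ D ∧ 0 ≤ y 0 ∧ y 0 < len (Fin.tail y)} := by
      refine ⟨?_, ?_, ?_⟩
      · simpa using hx
      · simp
      · simpa using hj
    have h1 := hP _ hy
    simp only [Fin.tail_cons, Fin.cons_zero] at h1
    rw [h1, cast_cons_prd, MvPolynomial.eval_eq_eval_mv_eval', Polynomial.eval_eq_sum_range'
      (lt_of_le_of_lt Polynomial.natDegree_map_le (Nat.lt_succ_self _))]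
    refine sum_congr rfl fun p _ => ?_
    rw [Polynomial.coeff_map, Int.cast_natCast]
  -- (2) the coefficient `c_p` has degree `≤ n − p` (or vanishes)
  have hcoef : ∀ p : ℕ, IsPolyOnDeg D (n - p) fun x => MvPolynomial.eval (fun i => (x i : ℚ)) (Q.coeff p) := by
    intro p
    by_cases h0 : Q.coeff p = 0
    · exact (IsPolyOnDeg.const 0).of_le (Nat.zero_le _) |>.congr fun x _ => by simp [h0]
    · refine ⟨Q.coeff p, ?_, fun x _ => rfl⟩
      have h := MvPolynomial.totalDegree_coeff_finSuccEquiv_add_le P p h0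
      rw [← hQ] at h
      omega
  -- (3) the candidate `Σ_p c_p(x) · F_p(len x)` has degree `≤ n + 1`
  have hcand : IsPolyOnDeg D (n + 1) fun x =>
      ∑ p ∈ range N, MvPolynomial.eval (fun i => (x i : ℚ)) (Q.coeff p) * (faulhaber p).eval (len x : ℚ) := by
    refine IsPolyOnDeg.sum _ _ fun p hp => ?_
    by_cases h0 : Q.coeff p = 0
    · exact (IsPolyOnDeg.const 0).of_le (Nat.zero_le _) |>.congr fun x _ => by simp [h0]
    · have hpn : p ≤ n := by
        have h := MvPolynomial.totalDegree_coeff_finSuccEquiv_add_le P p h0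
        omega
      have hdeg : (faulhaber p).natDegree ≤ p + 1 := by
        unfold faulhaber
        refine Polynomial.natDegree_sum_le_of_forall_le _ _ fun i _ => ?_
        exact (Polynomial.natDegree_C_mul_X_pow_le _ _).trans (Nat.sub_le _ _)
      have h1 := (hcoef p).mul (hlen.peval (faulhaber p) hdeg)
      exact h1.of_le (by omega)
  refine hcand.congr fun x hx => ?_
  -- (4) the identity on `D`
  have hl : ((len x).toNat : ℚ) = (len x : ℚ) := by exact_mod_cast Int.toNat_of_nonneg (hlen0 x hx)
  symm
  calc ∑ j ∈ range (len x).toNat, g x j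
      = ∑ j ∈ range (len x).toNat, ∑ p ∈ range N,
          MvPolynomial.eval (fun i => (x i : ℚ)) (Q.coeff p) * (j : ℚ) ^ p := by
        refine sum_congr rfl fun j hj => hexp x hx j ?_
        have := mem_range.1 hj
        have h0 := hlen0 x hx
        omega
    _ = ∑ p ∈ range N, MvPolynomial.eval (fun i => (x i : ℚ)) (Q.coeff p) *
          ∑ j ∈ range (len x).toNat, (j : ℚ) ^ p := by
        rw [sum_comm]
        refine sum_congr rfl fun p _ => ?_
        rw [mul_sum]
    _ = ∑ p ∈ range N, MvPolynomial.eval (fun i => (x i : ℚ)) (Q.coeff p) * (faulhaber p).eval (len x : ℚ) := by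
        refine sum_congr rfl fun p _ => ?_
        rw [← hl, eval_faulhaber]

/-- The same over the integer interval `[lo x, lo x + len x)` with `lo`, `len` AFFINE on `D` (`len ≥ 0`): total degree `≤ n + 1`.
[cite: Stanley2012EC1, §4.6.2, Theorem 4.6.8; KauersPaule2011, Sect. 3.3] -/
theorem IsPolyOnDeg.sum_range_shift {D : Set (Fin d → ℤ)} {lo len : (Fin d → ℤ) → ℤ} {g : (Fin d → ℤ) → ℤ → ℚ} {n : ℕ}
    (hlo : IsPolyOnDeg D 1 fun x => (lo x : ℚ)) (hlen : IsPolyOnDeg D 1 fun x => (len x : ℚ))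
    (hlen0 : ∀ x ∈ D, 0 ≤ len x)
    (hg : IsPolyOnDeg {y : Fin (d + 1) → ℤ | Fin.tail y ∈ D ∧ lo (Fin.tail y) ≤ y 0 ∧ y 0 < lo (Fin.tail y) + len (Fin.tail y)} n
      fun y => g (Fin.tail y) (y 0)) :
    IsPolyOnDeg D (n + 1) fun x => ∑ j ∈ range (len x).toNat, g x (lo x + j) := by
  set D' : Set (Fin (d + 1) → ℤ) := {y | Fin.tail y ∈ D ∧ 0 ≤ y 0 ∧ y 0 < len (Fin.tail y)} with hD'
  have hlo' : IsPolyOnDeg D' 1 fun y => (lo (Fin.tail y) : ℚ) := by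
    have h := hlo.comp (fun y => Fin.tail y) (fun i => IsPolyOnDeg.coord i.succ) fun y (hy : y ∈ D') => hy.1
    simpa using h
  have hsub : IsPolyOnDeg D' n fun y => g (Fin.tail y) (lo (Fin.tail y) + y 0) := by
    have hc := hg.comp (D := D') (a := 1) (fun y => Fin.cons (lo (Fin.tail y) + y 0) (Fin.tail y)) ?_ ?_
    · refine (hc.of_le (by omega)).congr fun y _ => ?_
      simp only [Fin.tail_cons, Fin.cons_zero]
    · intro j
      refine Fin.cases ?_ (fun i => ?_) j
      · simp only [Fin.cons_zero, Int.cast_add]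
        exact hlo'.add (IsPolyOnDeg.coord 0)
      · simp only [Fin.cons_succ]
        exact IsPolyOnDeg.coord i.succ
    · rintro y ⟨hyD, hy0, hy1⟩
      refine ⟨?_, ?_, ?_⟩
      · simpa only [Fin.tail_cons] using hyD
      · simp only [Fin.cons_zero, Fin.tail_cons]; omega
      · simp only [Fin.cons_zero, Fin.tail_cons]; omega
  exact IsPolyOnDeg.sum_range (g := fun x j => g x (lo x + j)) hlen hlen0 hsub

/-! ## One parameter -/

/-- On the ray `{n ≥ 0} ⊆ ℤ¹`, a function of degree `≤ m` on the chamber is a univariate polynomial of `natDegree ≤ m`.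
[cite: KauersPaule2011, Sect. 3.2; Stanley2012EC1, §4.4, Proposition 4.4.1] -/
theorem IsPolyOnDeg.exists_polynomial_nat {f : ℤ → ℚ} {m : ℕ} (h : IsPolyOnDeg {x : Fin 1 → ℤ | 0 ≤ x 0} m fun x => f (x 0)) :
    ∃ P : Polynomial ℚ, P.natDegree ≤ m ∧ ∀ n : ℕ, f n = P.eval (n : ℚ) := by
  obtain ⟨Q, hQd, hQ⟩ := h
  refine ⟨Polynomial.map (MvPolynomial.eval (Fin.elim0 : Fin 0 → ℚ)) (MvPolynomial.finSuccEquiv ℚ 0 Q), ?_, fun n => ?_⟩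
  · refine Polynomial.natDegree_map_le.trans ?_
    rw [MvPolynomial.natDegree_finSuccEquiv]
    exact (MvPolynomial.degreeOf_le_totalDegree Q 0).trans hQd
  · have h1 := hQ (fun _ => (n : ℤ)) (by simp)
    dsimp only at h1
    rw [h1, ← MvPolynomial.eval_eq_eval_mv_eval']
    refine congrArg (fun v => MvPolynomial.eval v Q) (funext fun i => ?_)
    refine Fin.cases ?_ (fun j => j.elim0) i
    simp

/-! ## Worked example -/

/-- The Beck–Robins pyramid count `t ↦ Σ_{0 ≤ m ≤ t} (t − m + 1)²` has degree `≤ 3` on `t ≥ 0` (it equals `(t+1)(t+2)(2t+3)/6`):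
`sum_range` with the affine length `t + 1` and the degree-`2` summand. [cite: Stanley2012EC1, §4.6.2, Theorem 4.6.8] -/
theorem isPolyOnDeg_pyramid :
    IsPolyOnDeg {x : Fin 1 → ℤ | 0 ≤ x 0} 3 fun x => ∑ m ∈ range (x 0 + 1).toNat, ((x 0 : ℚ) - m + 1) ^ 2 := by
  refine IsPolyOnDeg.sum_range (n := 2) (g := fun x m => ((x 0 : ℚ) - m + 1) ^ 2)
    (((IsPolyOnDeg.coord 0).add ((IsPolyOnDeg.const 1).of_le (Nat.zero_le 1))).congr fun x _ => by simp)
    (fun x hx => by have : 0 ≤ x 0 := hx; omega) ?_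
  have h1 : IsPolyOnDeg {y : Fin (1 + 1) → ℤ | Fin.tail y ∈ {x : Fin 1 → ℤ | 0 ≤ x 0} ∧ 0 ≤ y 0 ∧ y 0 < Fin.tail y 0 + 1} 1
      fun y => ((Fin.tail y 0 : ℚ) - y 0 + 1) :=
    ((IsPolyOnDeg.coord (1 : Fin 2)).sub (IsPolyOnDeg.coord 0)).add ((IsPolyOnDeg.const 1).of_le (Nat.zero_le 1))
  simpa using h1.pow 2

end Literature.Combinatorics.Enumerative.PolynomialRangeSums
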